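import Literature.NumberTheory.LFunctions.DworkRationality
import Literature.AlgebraicGeometry.Motives.ZetaFunctionProofs
import Mathlib.AlgebraicGeometry.Noetherian
import Mathlib.RingTheory.FinitePresentation
import Mathlib.Data.Set.Card
import HarnessLib

/-!
# Point counts of a finite-type scheme are combinations of affine-variety counts (proof file)

Sibling proof file of `Literature/NumberTheory/LFunctions/DworkRationality.lean`, which vendors as
a *named fact* `Literature.NumberTheory.LFunctions.Dwork.pointCount_eq_sum_systemCount`: for `X`
locally of finite type and quasi-compact over a finite field `k`, there are finitely many finite
polynomial systems `E_i ⊆ k[x_1, …, x_{n_i}]` and integers `c_i` with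
`#{P ∈ X(k̄) | φ^m P = P} = ∑_i c_i · #H_{E_i}(𝔽_{q^m})` for all `m ≥ 1`
(`Literature.AlgebraicGeometry.Motives.pointCount X m` on the left,
`Literature.NumberTheory.LFunctions.Dwork.systemCount k (E i) m` on the right). This is the
reduction of Dwork's rationality theorem for schemes of finite type to the case of affine
varieties (Koblitz, *p-adic Numbers, p-adic Analysis, and Zeta-Functions*, Ch. V §1, p. 122 and
Ex. 4 p. 124: "zeta-functions of hypersurfaces can be generalized to … affine or projective
algebraic varieties", `H_{(f_1,…,f_r)}(𝔽_{q^s})` = common zeros, `N_s = #H(𝔽_{q^s})`; Serre,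
*Zeta and L functions*, §1.6: `N_m` depends only on the points of `X` and their residue
fields). This file **discharges the fact**: `pointCount_eq_sum_systemCount_holds`.

## Proof

Write `S_m = {P ∈ X(k̄) | φ^m • P = P}` (finite for `m ≥ 1`,
`Literature.AlgebraicGeometry.Motives.finite_fixedPoints_arithFrob_pow_holds`) and, for an open
`W ⊆ X`, `N_m(W) = #{P ∈ S_m | P.pt ∈ W}`; call `N : ℕ → ℤ` a *system combination* if it
satisfies the conclusion of the fact (`N` is a fixed `ℤ`-combination of `systemCount`s for
`m ≥ 1`; spelled out in each statement, the file introduces no definition).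

* **Affine pieces** (`exists_systemCount_eq_natCard`). For an affine open `U = Spec A ⊆ X`,
  the `K`-points of `X` lying in `U` are the `k`-algebra maps `A → K` (a morphism `Spec K → X`
  with image in `U` factors through the open immersion `Spec A → X`, Mathlib
  `IsOpenImmersion.lift`, `Spec.preimage`; Hartshorne II Ex. 2.7), compatibly with the action of
  `σ ∈ Aut(K/k)` (`σ • P = Spec σ ≫ P ↔ σ ∘ ψ`) (`exists_ringHom_coords`);
  `A = k[x_1, …, x_n]/(E)` with `E` finite (`k` Noetherian, Mathlib
  `Algebra.FinitePresentation.of_finiteType`), so these are the common zeros of `E` in `Kⁿ`, `σ`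
  acting on coordinates (`exists_coords_of_finiteType`);
  for `K = k̄` and `σ = φ^m` (acting by `y ↦ y^{q^m}`,
  `Literature.AlgebraicGeometry.Motives.arithFrob_pow_smul`) the fixed points on both sides
  correspond, so `N_m(U) = systemCount k E m`.
* **Glueing** (inclusion–exclusion in its two-set form
  `N_m(W ∪ W') = N_m(W) + N_m(W') - N_m(W ∩ W')`, `natCard_sup`): `X` is Noetherian (Mathlib
  `LocallyOfFiniteType.isLocallyNoetherian`), so every open of `X` is quasi-compact; an open
  inside an affine open `U` is a finite union of basic opens `D(g) ⊆ U` (each affine, with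
  `D(g) ∩ D(h) = D(gh)`), whence `N(⋃_{l<r} D(g_l))` is a system combination by induction on `r`
  (`exists_eq_sum_systemCount_iSup_basicOpen`); finally induction over a finite affine open
  cover of `X` (`exists_eq_sum_systemCount_iSup_affineOpens`), the overlaps
  `U ∩ (U_1 ∪ ⋯ ∪ U_j)` being opens inside the affine `U`.

Koblitz's Ex. 4 (inclusion–exclusion over the equations) is `systemCount_eq_sum` of the
statement file; the present file is the scheme-theoretic half of the same reduction
(inclusion–exclusion over affine charts), which the sources leave implicit.

## References

* N. Koblitz, *p-adic Numbers, p-adic Analysis, and Zeta-Functions*, 2nd ed., GTM 58, Springer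
  (1984), doi:10.1007/978-1-4612-1112-9, Ch. V §1 (p. 122, Theorem (Dwork); Ex. 4–5 p. 124).
  [Koblitz1984]
* J.-P. Serre, *Zeta and L functions*, in Arithmetical Algebraic Geometry (1965), §1.6.
  [SerreZetaL1965]
* R. Hartshorne, *Algebraic Geometry*, GTM 52 (1977), II Ex. 2.7, II Prop. 2.2, App. C §1.
  [Hartshorne1977]

## Design notes

* Definition-free: the invariant of the glueing inductions ("system combination") is the
  conclusion of the fact written out. Imports: the statement file, the accepted
  `ZetaFunctionProofs` (finiteness of `S_m`, `arithFrob_pow_smul`), Mathlib.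
-/

open CategoryTheory AlgebraicGeometry

noncomputable section

universe u

namespace Literature.NumberTheory.LFunctions

namespace Dwork

open Literature.AlgebraicGeometry.Motives

/-! ### System combinations

The conclusion of the fact — "`N` is a fixed `ℤ`-linear combination of affine-variety counts
`m ↦ #H_E(𝔽_{q^m})` for `m ≥ 1`" — is spelled out in every statement below (no auxiliary
definition), as `∃ ι _ c n E, ∀ m, 0 < m → N m = ∑ i, c i * systemCount k (E i) m`; we call
such `N` *system combinations* in the docstrings. -/

section SystemCombination

variable {k : Type u} [Field k]

/-- System combinations only see `N_m`, `m ≥ 1`. [folklore] -/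
theorem exists_eq_sum_systemCount_congr {N N' : ℕ → ℤ}
    (h : ∃ (ι : Type) (_ : Fintype ι) (c : ι → ℤ) (n : ι → ℕ)
      (E : ∀ i, Finset (MvPolynomial (Fin (n i)) k)),
      ∀ m, 0 < m → N m = ∑ i, c i * (systemCount k (E i) m : ℤ))
    (e : ∀ m, 0 < m → N' m = N m) :
    ∃ (ι : Type) (_ : Fintype ι) (c : ι → ℤ) (n : ι → ℕ)
      (E : ∀ i, Finset (MvPolynomial (Fin (n i)) k)),
      ∀ m, 0 < m → N' m = ∑ i, c i * (systemCount k (E i) m : ℤ) := by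
  obtain ⟨ι, _, c, n, E, hN⟩ := h
  exact ⟨ι, ‹_›, c, n, E, fun m hm => (e m hm).trans (hN m hm)⟩

variable (k) in
/-- The zero sequence is a system combination (empty sum). [folklore] -/
theorem exists_eq_sum_systemCount_zero :
    ∃ (ι : Type) (_ : Fintype ι) (c : ι → ℤ) (n : ι → ℕ)
      (E : ∀ i, Finset (MvPolynomial (Fin (n i)) k)),
      ∀ m, 0 < m → (0 : ℕ → ℤ) m = ∑ i, c i * (systemCount k (E i) m : ℤ) :=
  ⟨PEmpty, inferInstance, PEmpty.elim, PEmpty.elim, fun i => PEmpty.elim i, fun m _ => by simp⟩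

/-- A single affine-variety count `m ↦ #H_E(𝔽_{q^m})` is a system combination. [folklore] -/
theorem exists_eq_sum_systemCount_single {n : ℕ} (E : Finset (MvPolynomial (Fin n) k)) :
    ∃ (ι : Type) (_ : Fintype ι) (c : ι → ℤ) (n : ι → ℕ)
      (E' : ∀ i, Finset (MvPolynomial (Fin (n i)) k)),
      ∀ m, 0 < m → (systemCount k E m : ℤ) = ∑ i, c i * (systemCount k (E' i) m : ℤ) :=
  ⟨Unit, inferInstance, fun _ => 1, fun _ => n, fun _ => E, fun m _ => by simp⟩

/-- Sums of system combinations are system combinations (disjoint union of the index sets).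
[folklore] -/
theorem exists_eq_sum_systemCount_add {N N' : ℕ → ℤ}
    (h : ∃ (ι : Type) (_ : Fintype ι) (c : ι → ℤ) (n : ι → ℕ)
      (E : ∀ i, Finset (MvPolynomial (Fin (n i)) k)),
      ∀ m, 0 < m → N m = ∑ i, c i * (systemCount k (E i) m : ℤ))
    (h' : ∃ (ι : Type) (_ : Fintype ι) (c : ι → ℤ) (n : ι → ℕ)
      (E : ∀ i, Finset (MvPolynomial (Fin (n i)) k)),
      ∀ m, 0 < m → N' m = ∑ i, c i * (systemCount k (E i) m : ℤ)) :
    ∃ (ι : Type) (_ : Fintype ι) (c : ι → ℤ) (n : ι → ℕ)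
      (E : ∀ i, Finset (MvPolynomial (Fin (n i)) k)),
      ∀ m, 0 < m → (N + N') m = ∑ i, c i * (systemCount k (E i) m : ℤ) := by
  obtain ⟨ι, _, c, n, E, hN⟩ := h
  obtain ⟨ι', _, c', n', E', hN'⟩ := h'
  refine ⟨ι ⊕ ι', inferInstance, Sum.elim c c', Sum.elim n n',
    fun i => match i with
      | Sum.inl i => E i
      | Sum.inr i => E' i, fun m hm => ?_⟩
  rw [Fintype.sum_sum_type, Pi.add_apply, hN m hm, hN' m hm]
  rfl

/-- Negatives of system combinations are system combinations. [folklore] -/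
theorem exists_eq_sum_systemCount_neg {N : ℕ → ℤ}
    (h : ∃ (ι : Type) (_ : Fintype ι) (c : ι → ℤ) (n : ι → ℕ)
      (E : ∀ i, Finset (MvPolynomial (Fin (n i)) k)),
      ∀ m, 0 < m → N m = ∑ i, c i * (systemCount k (E i) m : ℤ)) :
    ∃ (ι : Type) (_ : Fintype ι) (c : ι → ℤ) (n : ι → ℕ)
      (E : ∀ i, Finset (MvPolynomial (Fin (n i)) k)),
      ∀ m, 0 < m → (-N) m = ∑ i, c i * (systemCount k (E i) m : ℤ) := by
  obtain ⟨ι, _, c, n, E, hN⟩ := h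
  refine ⟨ι, ‹_›, fun i => -c i, n, E, fun m hm => ?_⟩
  rw [Pi.neg_apply, hN m hm, ← Finset.sum_neg_distrib]
  exact Finset.sum_congr rfl fun i _ => (neg_mul _ _).symm

/-- Differences of system combinations are system combinations. [folklore] -/
theorem exists_eq_sum_systemCount_sub {N N' : ℕ → ℤ}
    (h : ∃ (ι : Type) (_ : Fintype ι) (c : ι → ℤ) (n : ι → ℕ)
      (E : ∀ i, Finset (MvPolynomial (Fin (n i)) k)),
      ∀ m, 0 < m → N m = ∑ i, c i * (systemCount k (E i) m : ℤ))
    (h' : ∃ (ι : Type) (_ : Fintype ι) (c : ι → ℤ) (n : ι → ℕ)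
      (E : ∀ i, Finset (MvPolynomial (Fin (n i)) k)),
      ∀ m, 0 < m → N' m = ∑ i, c i * (systemCount k (E i) m : ℤ)) :
    ∃ (ι : Type) (_ : Fintype ι) (c : ι → ℤ) (n : ι → ℕ)
      (E : ∀ i, Finset (MvPolynomial (Fin (n i)) k)),
      ∀ m, 0 < m → (N - N') m = ∑ i, c i * (systemCount k (E i) m : ℤ) := by
  rw [sub_eq_add_neg]
  exact exists_eq_sum_systemCount_add h (exists_eq_sum_systemCount_neg h')

end SystemCombination

/-! ### Points of an affine open: ring homomorphisms and coordinates -/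

section AffinePiece

variable {k : Type u} [Field k] {X : SchemeOver k}

/-- **`U(K) = Hom_k(Γ(X, U), K)` for `U` affine, equivariantly.** For an affine open
`U = Spec A` of the `k`-scheme `X` and a field `K ⊇ k`, sending a `K`-point `P` of `X` lying in
`U` to the ring homomorphism `A → K` of its factorisation `Spec K → Spec A → X` through the
open immersion `Spec A → X` (Mathlib `IsOpenImmersion.lift`, `Spec.preimage`) is injective, its
image consists of the maps compatible with the structure map `φ : k → A` (`φ = Spec.preimage`
of `Spec A → X → Spec k`), and it transports the Galois action `σ • P = Spec σ ≫ P` to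
`ψ ↦ σ ∘ ψ` (Hartshorne, *Algebraic Geometry*, II Ex. 2.7 and Prop. 2.3, II Ex. 4.7).
[cite: Hartshorne1977, II Ex. 2.7] -/
theorem exists_ringHom_coords {U : X.left.Opens} (hU : IsAffineOpen U) (K : Type u) [Field K]
    [Algebra k K] :
    ∃ r : {P : AlgPoints X K // P.pt ∈ U} → (Γ(X.left, U) →+* K),
      Function.Injective r ∧
      Set.range r =
        {ψ | ψ.comp (Spec.preimage (hU.fromSpec ≫ X.hom)).hom = algebraMap k K} ∧
      ∀ (σ : K ≃ₐ[k] K) (P Q : {P : AlgPoints X K // P.pt ∈ U}), Q.1 = σ • P.1 →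
        r Q = (σ : K →+* K).comp (r P) := by
  set φ : CommRingCat.of k ⟶ Γ(X.left, U) := Spec.preimage (hU.fromSpec ≫ X.hom) with hφ_def
  have hφ : Spec.map φ = hU.fromSpec ≫ X.hom := Spec.map_preimage _
  -- every `K`-point lying in `U` factors through `Spec Γ(X, U) ⟶ X`
  have hsub : ∀ P : {P : AlgPoints X K // P.pt ∈ U},
      Set.range P.1.left ⊆ Set.range hU.fromSpec := by
    rintro ⟨P, hP⟩ _ ⟨y, rfl⟩
    rw [hU.range_fromSpec]
    obtain rfl : IsLocalRing.closedPoint K = y := Subsingleton.elim _ _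
    exact hP
  set g : ∀ P : {P : AlgPoints X K // P.pt ∈ U},
      Spec (CommRingCat.of K) ⟶ Spec Γ(X.left, U) :=
    fun P => IsOpenImmersion.lift hU.fromSpec P.1.left (hsub P) with hg_def
  have hg : ∀ P, g P ≫ hU.fromSpec = P.1.left := fun P => IsOpenImmersion.lift_fac _ _ _
  refine ⟨fun P => (Spec.preimage (g P)).hom, ?_, ?_, ?_⟩
  · -- injective
    intro P Q hPQ
    have h1 : Spec.preimage (g P) = Spec.preimage (g Q) := CommRingCat.hom_ext hPQ
    have h2 : g P = g Q := by rw [← Spec.map_preimage (g P), h1, Spec.map_preimage]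
    have h3 : P.1.left = Q.1.left := by rw [← hg P, ← hg Q, h2]
    exact Subtype.ext (Over.OverMorphism.ext h3)
  · -- range
    ext ψ
    constructor
    · rintro ⟨P, rfl⟩
      have h1 : φ ≫ Spec.preimage (g P) = CommRingCat.ofHom (algebraMap k K) := by
        apply Spec.map_injective
        rw [Spec.map_comp, Spec.map_preimage, hφ, ← Category.assoc, hg P]
        exact Over.w P.1
      have h2 := congrArg CommRingCat.Hom.hom h1
      rw [CommRingCat.hom_comp, CommRingCat.hom_ofHom] at h2
      exact h2
    · intro hψ
      -- the point `Spec K → Spec Γ(X, U) → X` attached to `ψ`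
      have hw : (Spec.map (CommRingCat.ofHom ψ) ≫ hU.fromSpec) ≫ X.hom =
          Spec.map (CommRingCat.ofHom (algebraMap k K)) := by
        rw [Category.assoc, ← hφ, ← Spec.map_comp]
        congr 1
        apply CommRingCat.hom_ext
        rw [CommRingCat.hom_comp, CommRingCat.hom_ofHom, CommRingCat.hom_ofHom]
        exact hψ
      have hpt : (AlgPoints.mk (Spec.map (CommRingCat.ofHom ψ) ≫ hU.fromSpec) hw :
          AlgPoints X K).pt ∈ U := by
        have : hU.fromSpec (Spec.map (CommRingCat.ofHom ψ) (IsLocalRing.closedPoint K)) ∈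
            Set.range hU.fromSpec :=
          Set.mem_range_self _
        rwa [hU.range_fromSpec] at this
      refine ⟨⟨AlgPoints.mk (Spec.map (CommRingCat.ofHom ψ) ≫ hU.fromSpec) hw, hpt⟩, ?_⟩
      have h1 : g ⟨_, hpt⟩ = Spec.map (CommRingCat.ofHom ψ) := by
        rw [← cancel_mono hU.fromSpec, hg]
        rfl
      change (Spec.preimage (g ⟨_, hpt⟩)).hom = ψ
      rw [h1, Spec.preimage_map, CommRingCat.hom_ofHom]
  · -- equivariance
    rintro σ P Q hQ
    have h1 : g Q = Spec.map (CommRingCat.ofHom (σ : K →+* K)) ≫ g P := by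
      rw [← cancel_mono hU.fromSpec, hg, Category.assoc, hg, hQ]
      rfl
    have h2 : Spec.preimage (g Q) = Spec.preimage (g P) ≫ CommRingCat.ofHom (σ : K →+* K) := by
      apply Spec.map_injective
      rw [Spec.map_preimage, Spec.map_comp, Spec.map_preimage, h1]
    change (Spec.preimage (g Q)).hom = (σ : K →+* K).comp (Spec.preimage (g P)).hom
    rw [h2, CommRingCat.hom_comp, CommRingCat.hom_ofHom]

/-- The structure map `φ : k → Γ(X, U)` of an affine open `U` of a `k`-scheme locally of finite
type is of finite type (`Spec φ = (Spec Γ(X, U) → X → Spec k)` is locally of finite type;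
Mathlib `HasRingHomProperty.Spec_iff`; Hartshorne II Ex. 3.3 (c)).
[cite: Hartshorne1977, II Ex. 3.3] -/
theorem finiteType_preimage_fromSpec [LocallyOfFiniteType X.hom] {U : X.left.Opens}
    (hU : IsAffineOpen U) : (Spec.preimage (hU.fromSpec ≫ X.hom)).hom.FiniteType := by
  have : LocallyOfFiniteType (Spec.map (Spec.preimage (hU.fromSpec ≫ X.hom))) := by
    rw [Spec.map_preimage]; infer_instance
  exact (HasRingHomProperty.Spec_iff (P := @LocallyOfFiniteType)).mp this

/-- **`Hom_k(A, K)` = common zeros, equivariantly.** For a `k`-algebra `A` of finite type,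
`A ≅ k[x_1, …, x_n]/(E)` with `E` finite (`k` is Noetherian; Mathlib
`Algebra.FinitePresentation.of_finiteType`), and `ψ ↦ (ψ(x_1), …, ψ(x_n))` is an injection of
the `k`-algebra maps `A → K` into `Kⁿ` with image the common zeros of `E`, transporting
`ψ ↦ σ ∘ ψ` to `σ` acting on coordinates (Koblitz, Ch. V §1 Ex. 4: the points of the affine
variety `H_{(f_1,…,f_r)}`; Hartshorne I.1 and II Ex. 2.7). [cite: Koblitz1984, Ch. V §1 Ex. 4] -/
theorem exists_coords_of_finiteType {A : Type u} [CommRing A] (φ : k →+* A)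
    (hφ : φ.FiniteType) :
    ∃ (n : ℕ) (E : Finset (MvPolynomial (Fin n) k)),
      ∀ (K : Type u) [Field K] [Algebra k K],
        ∃ c : {ψ : A →+* K // ψ.comp φ = algebraMap k K} → (Fin n → K),
          Function.Injective c ∧
          Set.range c = {v | ∀ f ∈ E, MvPolynomial.aeval v f = 0} ∧
          ∀ (σ : K ≃ₐ[k] K) (ψ ψ' : {ψ : A →+* K // ψ.comp φ = algebraMap k K}),
            ψ'.1 = (σ : K →+* K).comp ψ.1 → c ψ' = σ ∘ c ψ := by
  classical
  letI : Algebra k A := φ.toAlgebra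
  have hft : Algebra.FiniteType k A := hφ
  obtain ⟨n, F, hF, hker⟩ := (Algebra.FinitePresentation.of_finiteType.mp hft).out
  obtain ⟨E, hE⟩ := hker
  refine ⟨n, E, fun K _ _ => ?_⟩
  -- a compatible ring map is a `k`-algebra map; composed with `F` it is evaluation at `c ψ`
  let toAlg : {ψ : A →+* K // ψ.comp φ = algebraMap k K} → (A →ₐ[k] K) := fun ψ =>
    { toRingHom := ψ.1, commutes' := fun x => DFunLike.congr_fun ψ.2 x }
  have htoAlg : ∀ ψ a, toAlg ψ a = ψ.1 a := fun _ _ => rfl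
  set c : {ψ : A →+* K // ψ.comp φ = algebraMap k K} → (Fin n → K) :=
    fun ψ i => ψ.1 (F (MvPolynomial.X i)) with hc_def
  have hcF : ∀ ψ p, ψ.1 (F p) = MvPolynomial.aeval (c ψ) p := by
    intro ψ p
    have : (toAlg ψ).comp F = MvPolynomial.aeval (c ψ) :=
      MvPolynomial.algHom_ext fun i => by simp [htoAlg, hc_def]
    rw [← htoAlg, ← AlgHom.comp_apply, this]
  refine ⟨c, ?_, ?_, ?_⟩
  · -- injective: `F` is surjective
    intro ψ ψ' h
    apply Subtype.ext
    refine RingHom.ext fun a => ?_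
    obtain ⟨p, rfl⟩ := hF a
    rw [hcF, hcF, h]
  · -- range = common zeros of `E`
    ext v
    constructor
    · rintro ⟨ψ, rfl⟩ f hf
      have hf' : F f = 0 := by
        have : f ∈ RingHom.ker F.toRingHom := by rw [← hE]; exact Ideal.subset_span hf
        exact this
      rw [← hcF, hf', map_zero]
    · intro hv
      have hle : RingHom.ker F.toRingHom ≤ RingHom.ker (MvPolynomial.aeval v).toRingHom := by
        rw [← hE, Ideal.span_le]
        intro f hf
        exact hv f hf
      let ψ : A →+* K :=
        F.toRingHom.liftOfSurjective hF ⟨(MvPolynomial.aeval v).toRingHom, hle⟩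
      have hψF : ∀ p, ψ (F p) = MvPolynomial.aeval v p := fun p =>
        F.toRingHom.liftOfSurjective_comp_apply hF _ p
      have hψ : ψ.comp φ = algebraMap k K := by
        ext x
        have h1 : φ x = F (algebraMap k _ x) := (F.commutes x).symm
        rw [RingHom.comp_apply, h1, hψF, AlgHom.commutes]
      refine ⟨⟨ψ, hψ⟩, funext fun i => ?_⟩
      simp only [hc_def, hψF, MvPolynomial.aeval_X]
  · -- equivariance
    rintro σ ψ ψ' h
    funext i
    simp only [hc_def, h, Function.comp_apply, RingHom.coe_comp, RingHom.coe_coe]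

/-- Counting fixed points through an equivariant coordinatisation: if `C` injects the
`K`-points of `X` lying in `U` into `Kⁿ` with image `R`, compatibly with `σ`, then the `σ`-fixed
points lying in `U` are in bijection with the `σ`-fixed vectors in `R`. [folklore] -/
theorem natCard_fixedPoints_eq_of_coords {K : Type u} [Field K] [Algebra k K] (σ : K ≃ₐ[k] K)
    {U : X.left.Opens} {n : ℕ} {R : Set (Fin n → K)}
    (C : {P : AlgPoints X K // P.pt ∈ U} → (Fin n → K)) (hinj : Function.Injective C)
    (hrange : Set.range C = R)
    (hequiv : ∀ P Q : {P : AlgPoints X K // P.pt ∈ U}, Q.1 = σ • P.1 → C Q = σ ∘ C P) :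
    Nat.card {P : AlgPoints X K // σ • P = P ∧ P.pt ∈ U} =
      Nat.card {v : Fin n → K // (∀ i, σ (v i) = v i) ∧ v ∈ R} := by
  -- `σ • Q = Q` iff the coordinates of `Q` are fixed by `σ`
  have key : ∀ Q : {P : AlgPoints X K // P.pt ∈ U}, σ • Q.1 = Q.1 ↔ σ ∘ C Q = C Q := by
    intro Q
    let Q' : {P : AlgPoints X K // P.pt ∈ U} :=
      ⟨σ • Q.1, by rw [AlgPoints.pt_smul]; exact Q.2⟩
    have hQ' : C Q' = σ ∘ C Q := hequiv Q Q' rfl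
    constructor
    · intro h
      have : Q' = Q := Subtype.ext h
      rw [← hQ', this]
    · intro h
      have : Q' = Q := hinj (hQ'.trans h)
      exact congrArg Subtype.val this
  calc Nat.card {P : AlgPoints X K // σ • P = P ∧ P.pt ∈ U}
      = Nat.card {P : AlgPoints X K // P.pt ∈ U ∧ σ • P = P} :=
        Nat.card_congr (Equiv.subtypeEquivRight fun _ => and_comm)
    _ = Nat.card {Q : {P : AlgPoints X K // P.pt ∈ U} // σ • Q.1 = Q.1} :=
        Nat.card_congr (Equiv.subtypeSubtypeEquivSubtypeInter (fun P : AlgPoints X K => P.pt ∈ U)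
          (fun P => σ • P = P)).symm
    _ = Nat.card {w : Set.range C // σ ∘ w.1 = w.1} :=
        Nat.card_congr ((Equiv.ofInjective C hinj).subtypeEquiv fun Q => by
          rw [key]; rfl)
    _ = Nat.card {v : Fin n → K // v ∈ Set.range C ∧ σ ∘ v = v} :=
        Nat.card_congr (Equiv.subtypeSubtypeEquivSubtypeInter (fun v => v ∈ Set.range C)
          (fun v => σ ∘ v = v))
    _ = Nat.card {v : Fin n → K // (∀ i, σ (v i) = v i) ∧ v ∈ R} :=
        Nat.card_congr (Equiv.subtypeEquivRight fun v => by
          rw [hrange, and_comm, funext_iff]; rfl)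

variable [Finite k]

/-- **The affine pieces.** For `X` locally of finite type over the finite field `k` and an
affine open `U ⊆ X`, there is a finite polynomial system `E ⊆ k[x_1, …, x_n]` (a presentation
`Γ(X, U) = k[x]/(E)`) such that for every `m` the `φ^m`-fixed `k̄`-points of `X` lying in `U`
are equinumerous with the common zeros of `E` in `𝔽_{q^m}ⁿ = {x ∈ k̄ⁿ | x^{q^m} = x}`:
`#{P ∈ X(k̄) | φ^m P = P, P ∈ U} = #H_E(𝔽_{q^m}) = systemCount k E m` (`φ^m` acts on
coordinates by `y ↦ y^{q^m}`). (Koblitz, Ch. V §1 Ex. 4; Serre, *Zeta and L functions*, §1.6;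
Hartshorne, App. C §1, "points whose coordinates lie in `k_r`".)
[cite: Koblitz1984, Ch. V §1 Ex. 4] -/
theorem exists_systemCount_eq_natCard [LocallyOfFiniteType X.hom] {U : X.left.Opens}
    (hU : IsAffineOpen U) :
    ∃ (n : ℕ) (E : Finset (MvPolynomial (Fin n) k)), ∀ m : ℕ,
      Nat.card {P : AlgPoints X (AlgebraicClosure k) // arithFrob k ^ m • P = P ∧ P.pt ∈ U} =
        systemCount k E m := by
  obtain ⟨n, E, hE⟩ := exists_coords_of_finiteType _ (finiteType_preimage_fromSpec hU)
  refine ⟨n, E, fun m => ?_⟩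
  obtain ⟨r, hr, hr_range, hr_equiv⟩ := exists_ringHom_coords hU (AlgebraicClosure k)
  obtain ⟨c, hc, hc_range, hc_equiv⟩ := hE (AlgebraicClosure k)
  -- the coordinatisation `C = c ∘ r` of the points lying in `U`
  have hmem : ∀ P, r P ∈ {ψ : Γ(X.left, U) →+* AlgebraicClosure k |
      ψ.comp (Spec.preimage (hU.fromSpec ≫ X.hom)).hom = algebraMap k (AlgebraicClosure k)} :=
    fun P => hr_range ▸ Set.mem_range_self P
  let C : {P : AlgPoints X (AlgebraicClosure k) // P.pt ∈ U} → (Fin n → AlgebraicClosure k) :=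
    fun P => c ⟨r P, hmem P⟩
  set σ : AlgebraicClosure k ≃ₐ[k] AlgebraicClosure k :=
    Field.absoluteGaloisGroup.toAlgEquiv k (arithFrob k ^ m) with hσ
  have hCinj : Function.Injective C := fun P Q h => hr (congrArg Subtype.val (hc h))
  have hCrange : Set.range C = {v | ∀ f ∈ E, MvPolynomial.aeval v f = 0} := by
    rw [← hc_range]
    ext v
    constructor
    · rintro ⟨P, rfl⟩
      exact ⟨_, rfl⟩
    · rintro ⟨⟨ψ, hψ⟩, rfl⟩
      have : ψ ∈ Set.range r := by rw [hr_range]; exact hψ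
      obtain ⟨P, rfl⟩ := this
      exact ⟨P, rfl⟩
  have hCequiv : ∀ P Q : {P : AlgPoints X (AlgebraicClosure k) // P.pt ∈ U},
      Q.1 = σ • P.1 → C Q = σ ∘ C P :=
    fun P Q h => hc_equiv σ ⟨r P, hmem P⟩ ⟨r Q, hmem Q⟩ (hr_equiv σ P Q h)
  have h := natCard_fixedPoints_eq_of_coords σ C hCinj hCrange hCequiv
  -- `arithFrob k ^ m • P = σ • P` and `σ y = y ↔ y ^ (q ^ m) = y`
  have hsmul : ∀ P : AlgPoints X (AlgebraicClosure k), arithFrob k ^ m • P = σ • P :=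
    fun P => by rw [AlgPoints.absoluteGaloisGroup_smul_def, ← AlgPoints.smul_def]
  have hfix : ∀ y : AlgebraicClosure k, σ y = y ↔ y ^ Nat.card k ^ m = y := fun y => by
    rw [hσ, ← Field.absoluteGaloisGroup.smul_def, arithFrob_pow_smul]
  simp only [hsmul]
  rw [h, systemCount]
  refine Nat.card_congr (Equiv.subtypeEquivRight fun v => ?_)
  simp only [IsFixedVec, hfix, Set.mem_setOf_eq]

end AffinePiece

/-! ### Glueing: two-set inclusion–exclusion and basic opens -/

section Glue

variable {k : Type u} [Field k] [Finite k] {X : SchemeOver k}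

/-- **Two-set inclusion–exclusion for the fixed-point counts.** For `m ≥ 1` and opens
`W, W' ⊆ X` (`X` of finite type over the finite field `k`, so that the `φ^m`-fixed `k̄`-points
form a finite set, `finite_fixedPoints_arithFrob_pow_holds`):
`N_m(W ∪ W') = N_m(W) + N_m(W') - N_m(W ∩ W')` (Koblitz, Ch. V §4: the zeta function of a union
is the product of the zeta functions divided by that of the overlap).
[cite: Koblitz1984, Ch. V §4] -/
theorem natCard_sup [LocallyOfFiniteType X.hom] [QuasiCompact X.hom] {m : ℕ} (hm : 0 < m)
    (W W' : X.left.Opens) :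
    (Nat.card {P : AlgPoints X (AlgebraicClosure k) //
        arithFrob k ^ m • P = P ∧ P.pt ∈ W ⊔ W'} : ℤ) =
      Nat.card {P : AlgPoints X (AlgebraicClosure k) // arithFrob k ^ m • P = P ∧ P.pt ∈ W} +
      Nat.card {P : AlgPoints X (AlgebraicClosure k) // arithFrob k ^ m • P = P ∧ P.pt ∈ W'} -
      Nat.card {P : AlgPoints X (AlgebraicClosure k) //
        arithFrob k ^ m • P = P ∧ P.pt ∈ W ⊓ W'} := by
  have hfin : Set.Finite {P : AlgPoints X (AlgebraicClosure k) | arithFrob k ^ m • P = P} :=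
    Set.finite_coe_iff.mp (finite_fixedPoints_arithFrob_pow_holds (X := X) hm)
  set A : Set (AlgPoints X (AlgebraicClosure k)) := {P | arithFrob k ^ m • P = P ∧ P.pt ∈ W}
  set B : Set (AlgPoints X (AlgebraicClosure k)) := {P | arithFrob k ^ m • P = P ∧ P.pt ∈ W'}
  have hA : A.Finite := hfin.subset fun P hP => hP.1
  have hB : B.Finite := hfin.subset fun P hP => hP.1
  have hAB : A ∪ B = {P | arithFrob k ^ m • P = P ∧ P.pt ∈ W ⊔ W'} := by
    ext P
    simp only [A, B, Set.mem_union, Set.mem_setOf_eq, TopologicalSpace.Opens.mem_sup]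
    tauto
  have hAB' : A ∩ B = {P | arithFrob k ^ m • P = P ∧ P.pt ∈ W ⊓ W'} := by
    ext P
    simp only [A, B, Set.mem_inter_iff, Set.mem_setOf_eq, TopologicalSpace.Opens.mem_inf]
    tauto
  have h := Set.ncard_union_add_ncard_inter A B hA hB
  rw [hAB, hAB'] at h
  simp only [← Nat.card_coe_set_eq] at h
  have h' := congrArg (fun n : ℕ => (n : ℤ)) h
  simp only [Nat.cast_add] at h'
  change ((Nat.card {P : AlgPoints X (AlgebraicClosure k) //
        arithFrob k ^ m • P = P ∧ P.pt ∈ W ⊔ W'} : ℕ) : ℤ) +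
      Nat.card {P : AlgPoints X (AlgebraicClosure k) //
        arithFrob k ^ m • P = P ∧ P.pt ∈ W ⊓ W'} =
    Nat.card {P : AlgPoints X (AlgebraicClosure k) // arithFrob k ^ m • P = P ∧ P.pt ∈ W} +
      Nat.card {P : AlgPoints X (AlgebraicClosure k) //
        arithFrob k ^ m • P = P ∧ P.pt ∈ W'} at h'
  omega

/-- **Finite unions of basic opens of an affine open.** For `U ⊆ X` affine and sections
`g_0, …, g_{r-1} ∈ Γ(X, U)`, the counts `m ↦ N_m(D(g_0) ∪ ⋯ ∪ D(g_{r-1}))` form a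
system combination: induction on `r` with the two-set formula, `D(g) ∩ D(h) = D(gh)` (Mathlib
`Scheme.basicOpen_mul`) and the affine pieces `D(g)` (Hartshorne II Prop. 2.2; Koblitz, Ch. V
§4). [cite: Koblitz1984, Ch. V §4] -/
theorem exists_eq_sum_systemCount_iSup_basicOpen [LocallyOfFiniteType X.hom]
    [QuasiCompact X.hom] {U : X.left.Opens} (hU : IsAffineOpen U) (r : ℕ)
    (g : Fin r → Γ(X.left, U)) :
    ∃ (ι : Type) (_ : Fintype ι) (c : ι → ℤ) (n : ι → ℕ)
      (E : ∀ i, Finset (MvPolynomial (Fin (n i)) k)),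
      ∀ m, 0 < m → (Nat.card {P : AlgPoints X (AlgebraicClosure k) //
          arithFrob k ^ m • P = P ∧ P.pt ∈ ⨆ l, X.left.basicOpen (g l)} : ℤ) =
        ∑ i, c i * (systemCount k (E i) m : ℤ) := by
  induction r with
  | zero =>
    refine exists_eq_sum_systemCount_congr (exists_eq_sum_systemCount_zero k) fun m _ => ?_
    rw [Pi.zero_apply, Nat.cast_eq_zero, iSup_of_empty]
    haveI : IsEmpty {P : AlgPoints X (AlgebraicClosure k) //
        arithFrob k ^ m • P = P ∧ P.pt ∈ (⊥ : X.left.Opens)} := ⟨fun P => P.2.2⟩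
    exact Nat.card_of_isEmpty
  | succ r ih =>
    have hsplit : (⨆ l, X.left.basicOpen (g l)) =
        (⨆ l : Fin r, X.left.basicOpen (g (Fin.castSucc l))) ⊔
          X.left.basicOpen (g (Fin.last r)) := by
      apply le_antisymm
      · refine iSup_le fun l => ?_
        induction l using Fin.lastCases with
        | last => exact le_sup_right
        | cast l =>
          exact le_sup_of_le_left
            (le_iSup (fun l : Fin r => X.left.basicOpen (g (Fin.castSucc l))) l)
      · refine sup_le (iSup_le fun l => le_iSup (fun l => X.left.basicOpen (g l)) _) ?_
        exact le_iSup (fun l => X.left.basicOpen (g l)) (Fin.last r)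
    have hinf : (⨆ l : Fin r, X.left.basicOpen (g (Fin.castSucc l))) ⊓
          X.left.basicOpen (g (Fin.last r)) =
        ⨆ l : Fin r, X.left.basicOpen (g (Fin.castSucc l) * g (Fin.last r)) := by
      rw [iSup_inf_eq]
      exact iSup_congr fun l => (Scheme.basicOpen_mul _ _ _).symm
    obtain ⟨n, E, hE⟩ := exists_systemCount_eq_natCard (k := k) (hU.basicOpen (g (Fin.last r)))
    refine exists_eq_sum_systemCount_congr (exists_eq_sum_systemCount_sub
      (exists_eq_sum_systemCount_add (ih fun l => g (Fin.castSucc l))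
        (exists_eq_sum_systemCount_single E))
      (ih fun l => g (Fin.castSucc l) * g (Fin.last r))) fun m hm => ?_
    simp only [Pi.add_apply, Pi.sub_apply, ← hE m]
    rw [hsplit, natCard_sup hm, hinf]

/-- A quasi-compact open inside an affine open `U` is a finite union of basic opens `D(g)`,
`g ∈ Γ(X, U)` (the `D(g)` form a basis of `U = Spec Γ(X, U)`; Mathlib
`IsAffineOpen.exists_basicOpen_le`; Hartshorne II Prop. 2.2 and Ex. 2.13).
[cite: Hartshorne1977, II Prop. 2.2] -/
theorem exists_eq_iSup_basicOpen {Y : Scheme.{u}} {U W : Y.Opens} (hU : IsAffineOpen U)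
    (hWU : W ≤ U) (hW : IsCompact (W : Set Y)) :
    ∃ (r : ℕ) (g : Fin r → Γ(Y, U)), W = ⨆ l, Y.basicOpen (g l) := by
  classical
  choose f hf using fun x : W => hU.exists_basicOpen_le x (hWU x.2)
  obtain ⟨t, ht⟩ := hW.elim_finite_subcover (fun x : W => (Y.basicOpen (f x) : Set Y))
    (fun x => (Y.basicOpen (f x)).isOpen) fun x hx =>
      Set.mem_iUnion.mpr ⟨⟨x, hx⟩, (hf ⟨x, hx⟩).2⟩
  refine ⟨t.card, fun l => f (t.equivFin.symm l), le_antisymm ?_ ?_⟩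
  · intro x hx
    obtain ⟨y, hy⟩ := Set.mem_iUnion.mp (ht hx)
    obtain ⟨hyt, hxy⟩ := Set.mem_iUnion.mp hy
    refine TopologicalSpace.Opens.mem_iSup.mpr ⟨t.equivFin ⟨y, hyt⟩, ?_⟩
    simpa using hxy
  · exact iSup_le fun l => (hf _).1

omit [Finite k] in
/-- A scheme locally of finite type and quasi-compact over a field is Noetherian, hence its
underlying space is Noetherian: every open is quasi-compact (Mathlib
`LocallyOfFiniteType.isLocallyNoetherian`, `IsNoetherian.noetherianSpace`; Hartshorne II §3,
Ex. 3.3 and II Ex. 2.13). [folklore] -/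
theorem noetherianSpace_left (X : SchemeOver k) [LocallyOfFiniteType X.hom] [QuasiCompact X.hom] :
    TopologicalSpace.NoetherianSpace X.left := by
  haveI : IsLocallyNoetherian X.left := LocallyOfFiniteType.isLocallyNoetherian X.hom
  haveI : CompactSpace X.left := QuasiCompact.compactSpace_of_compactSpace X.hom
  haveI : IsNoetherian X.left := {}
  infer_instance

/-- **Finite unions of affine opens.** For `X` of finite type over the finite field `k` and a
finite family of affine opens `V_j`, the counts `m ↦ N_m(⋃_{j ∈ T} V_j)` form a system
combination: induction on `T` with the two-set formula; the overlap `V_j ∩ ⋃_{T} V_{j'}` is a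
quasi-compact open inside the affine `V_j`, hence a finite union of basic opens
(Koblitz, Ch. V §4, "the zeta-function for the union … is the product … divided by … the
overlaps"; Serre, *Zeta and L functions*, §1.6). [cite: Koblitz1984, Ch. V §4] -/
theorem exists_eq_sum_systemCount_iSup_affineOpens [LocallyOfFiniteType X.hom]
    [QuasiCompact X.hom] {J : Type*} (V : J → X.left.Opens) (hV : ∀ j, IsAffineOpen (V j))
    (T : Finset J) :
    ∃ (ι : Type) (_ : Fintype ι) (c : ι → ℤ) (n : ι → ℕ)
      (E : ∀ i, Finset (MvPolynomial (Fin (n i)) k)),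
      ∀ m, 0 < m → (Nat.card {P : AlgPoints X (AlgebraicClosure k) //
          arithFrob k ^ m • P = P ∧ P.pt ∈ ⨆ j ∈ T, V j} : ℤ) =
        ∑ i, c i * (systemCount k (E i) m : ℤ) := by
  classical
  haveI := noetherianSpace_left X
  induction T using Finset.induction_on with
  | empty =>
    refine exists_eq_sum_systemCount_congr (exists_eq_sum_systemCount_zero k) fun m _ => ?_
    rw [Pi.zero_apply, Nat.cast_eq_zero]
    haveI : IsEmpty {P : AlgPoints X (AlgebraicClosure k) //
        arithFrob k ^ m • P = P ∧ P.pt ∈ ⨆ j ∈ (∅ : Finset J), V j} := ⟨fun P => by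
      have h := P.2.2
      simp at h⟩
    exact Nat.card_of_isEmpty
  | insert j T hj ih =>
    obtain ⟨n, E, hE⟩ := exists_systemCount_eq_natCard (k := k) (hV j)
    obtain ⟨r, g, hg⟩ := exists_eq_iSup_basicOpen (hV j) (W := V j ⊓ ⨆ j' ∈ T, V j')
      inf_le_left (TopologicalSpace.NoetherianSpace.isCompact _)
    refine exists_eq_sum_systemCount_congr (exists_eq_sum_systemCount_sub
      (exists_eq_sum_systemCount_add (exists_eq_sum_systemCount_single E) ih)
      (exists_eq_sum_systemCount_iSup_basicOpen (hV j) r g)) fun m hm => ?_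
    simp only [Pi.add_apply, Pi.sub_apply, ← hE m, ← hg]
    rw [Finset.iSup_insert, natCard_sup hm]

end Glue

/-! ### The discharge -/

/-- **Discharge of `pointCount_eq_sum_systemCount`.** For `X` locally of finite type and
quasi-compact over a finite field `k`, the point counts `N_m(X) = #{P ∈ X(k̄) | φ^m P = P}`,
`m ≥ 1`, are a fixed `ℤ`-linear combination of affine-variety counts `#H_{E_i}(𝔽_{q^m})` of
finitely many finite polynomial systems `E_i` over `k`: cover `X` by finitely many affine opens
(`X` is quasi-compact) and apply `exists_eq_sum_systemCount_iSup_affineOpens` (Koblitz, *p-adic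
Numbers, p-adic Analysis, and Zeta-Functions*, Ch. V §1, p. 122 and Ex. 4–5, p. 124; Serre,
*Zeta and L functions*, §1.6). [cite: Koblitz1984, Ch. V §1 Ex. 4] -/
theorem pointCount_eq_sum_systemCount_holds : pointCount_eq_sum_systemCount.{u} := by
  intro k _ _ X _ _
  classical
  haveI : CompactSpace X.left := QuasiCompact.compactSpace_of_compactSpace X.hom
  let 𝒰 : X.left.OpenCover := X.left.affineCover.finiteSubcover
  haveI : ∀ j, IsAffine (𝒰.X j) := fun j => by
    change IsAffine ((X.left.affineCover.finiteSubcover).X j)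
    rw [Scheme.OpenCover.finiteSubcover_X]
    infer_instance
  let V : 𝒰.I₀ → X.left.Opens := fun j => (𝒰.f j).opensRange
  have hV : ∀ j, IsAffineOpen (V j) := fun j => isAffineOpen_opensRange (𝒰.f j)
  have hcov : (⨆ j ∈ (Finset.univ : Finset 𝒰.I₀), V j) = ⊤ := by
    refine top_le_iff.mp fun x _ => ?_
    refine TopologicalSpace.Opens.mem_iSup.mpr ⟨𝒰.idx x, TopologicalSpace.Opens.mem_iSup.mpr
      ⟨Finset.mem_univ _, 𝒰.covers x⟩⟩
  obtain ⟨ι, _, c, n, E, h⟩ :=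
    exists_eq_sum_systemCount_iSup_affineOpens (k := k) V hV Finset.univ
  refine ⟨ι, ‹_›, c, n, E, fun m hm => ?_⟩
  rw [← h m hm, hcov, pointCount]
  exact congrArg (fun n : ℕ => (n : ℤ)) (Nat.card_congr
    (Equiv.subtypeEquivRight fun P => (and_iff_left (TopologicalSpace.Opens.mem_top P.pt)).symm))

end Dwork

end Literature.NumberTheory.LFunctions

end
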